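import Literature.NumberTheory.LFunctions.ConreyIwaniec2002CircleMethodDefs
import Mathlib.Analysis.Fourier.Inversion
import Mathlib.Analysis.SpecialFunctions.JapaneseBracket
import Mathlib.MeasureTheory.Measure.Haar.NormedSpace
import HarnessLib

/-!
# Conrey–Iwaniec (2002), proof of Theorem 4.1: the Fourier-analytic inputs (4.8), (4.9), Plancherel

B. Conrey, H. Iwaniec, *Spacing of zeros of Hecke `L`-functions and the class number problem*,
Acta Arith. 103 (2002) 259–312, §4 [held text `paper:arxiv-math_0111012`, p0010:L45–56,
p0011:L45–60, p0012:L58–66]. For the test functions of (4.18)/(4.23) on `[X, 2X]`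
(`IsBumpOn X g`) the decay (4.24) `|ĝ(α)| ≤ c₁X(1 + |α|X)^{-2}` (the registered interface
`BumpFourierDecay c₁`, stub S3a of SKELETON S3, proved in the tree with `c₁ = 4`) gives
"(4.8) and (4.9) hold with `B = 1`" up to absolute constants; this file records these consequences
in the shape consumed by the assembly of Theorem 4.1 (registered stub S3b3 `stub_circle_assembly`,
cell `landau-siegel/ls-inputs`, line `theta-circle-method`):

* `integrable_fourier_bump`, `integral_norm_fourier_le` — (4.8): `∫|ĝ(α)|dα ≤ c₁·I₂`,
  `I₂ = ∫(1+|u|)^{-2}du`;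
* `integral_abs_mul_norm_fourier_le` — (4.9) for a pair: `∫|α||ĝ₁(α)||ĝ₂(α)|dα ≤ c₁²·I₃`,
  `I₃ = ∫(1+|u|)^{-3}du` (whence also the tail `∫_{|α|>T}|ĝ₁ĝ₂| ≤ c₁²I₃/T` used when "in the
  leading term we extend the integration to all `α ∈ ℝ`");
* `integral_fourier_mul_conj_fourier_conj_mul_fourierChar` — "by the Plancherel theorem
  `∫ e(αh)|ĝ(α)|²dα = ∫ g(x+h)ḡ(x)dx`", in the two-function form of the Remarks after (4.17):
  `∫ ĝ₁(α)·conj((conj g₂)^(α))·e(hα)dα = ∫ g₁(x+h)g₂(x)dx` (Mathlib's multiplication formula +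
  Fourier inversion for the continuous integrable `g₂` with integrable transform);
* `isBumpOn_conj`, `contDiff_test`/`test_eq_zero`, `integral_Ioi_test_mul_eq_fourier` — the
  test function `g(x)e(−αx)` to which the summation formula (4.3) is applied
  ("`S(a/c − α) = Σ_m ψ_m(a)e(d l_m/c)ĝ_m(α)`", `ĝ_m(α) = ∫g(x)k_m(x)e(−αx)dx`).

## References

* [ConreyIwaniec2002] B. Conrey, H. Iwaniec, Acta Arith. 103 (2002) 259–312, arXiv:math/0111012:
  §4 (4.8)–(4.9), (4.18), (4.24), proof of Theorem 4.1 (Plancherel step), Remarks after (4.17).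
-/

noncomputable section

open scoped FourierTransform ComplexConjugate
open Complex MeasureTheory Set

namespace Literature.NumberTheory.LFunctions

namespace ConreyIwaniec2002

namespace CircleMethod

variable {X c₁ : ℝ} {g g₁ g₂ : ℝ → ℂ}

/-! ### Elementary facts about the test functions (4.18) -/

/-- A test function of (4.18) is continuous. [cite: ConreyIwaniec2002, §4 (4.18)] -/
theorem continuous_of_isBumpOn (hg : IsBumpOn X g) : Continuous g := hg.1.continuous

/-- A test function of (4.18) has compact support. [cite: ConreyIwaniec2002, §4 (4.18)] -/
theorem hasCompactSupport_of_isBumpOn (hg : IsBumpOn X g) : HasCompactSupport g :=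
  HasCompactSupport.intro isCompact_Icc hg.2.1

/-- A test function of (4.18) is integrable. [cite: ConreyIwaniec2002, §4 (4.18)] -/
theorem integrable_of_isBumpOn (hg : IsBumpOn X g) : Integrable g :=
  (continuous_of_isBumpOn hg).integrable_of_hasCompactSupport (hasCompactSupport_of_isBumpOn hg)

/-- `|g| ≤ 1` for a test function of (4.18) (`ν = 0`). [cite: ConreyIwaniec2002, §4 (4.18)] -/
theorem norm_le_one_of_isBumpOn (hg : IsBumpOn X g) (x : ℝ) : ‖g x‖ ≤ 1 := by
  simpa using hg.2.2 0 (by norm_num) x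

/-- A test function on `[X, 2X]`, `X ≥ 1/2`, vanishes at `x ≤ 0` and outside `[X, 2X]`.
[cite: ConreyIwaniec2002, §4 (4.18)] -/
theorem eq_zero_of_isBumpOn (hg : IsBumpOn X g) {x : ℝ} (hx : x ∉ Icc X (2 * X)) : g x = 0 :=
  hg.2.1 x hx

/-- `∫|g| ≤ X` for a test function of (4.18) (`|g| ≤ 1` on `[X, 2X]`, `0` outside).
[cite: ConreyIwaniec2002, §4 (4.18)] -/
theorem integral_norm_le_of_isBumpOn (hX : 1 / 2 ≤ X) (hg : IsBumpOn X g) :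
    ∫ x, ‖g x‖ ≤ X := by
  have hX0 : 0 ≤ X := by linarith
  have hle : ∀ v : ℝ, ‖g v‖ ≤ (Icc X (2 * X)).indicator (fun _ ↦ (1 : ℝ)) v := by
    intro v
    by_cases hv : v ∈ Icc X (2 * X)
    · rw [indicator_of_mem hv]; exact norm_le_one_of_isBumpOn hg v
    · rw [indicator_of_notMem hv, eq_zero_of_isBumpOn hg hv, norm_zero]
  have hint : Integrable ((Icc X (2 * X)).indicator fun _ : ℝ ↦ (1 : ℝ)) volume :=
    (continuous_const.integrableOn_Icc (μ := volume)).integrable_indicator measurableSet_Icc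
  calc ∫ v : ℝ, ‖g v‖ ≤ ∫ v : ℝ, (Icc X (2 * X)).indicator (fun _ ↦ (1 : ℝ)) v :=
        integral_mono_of_nonneg (Filter.Eventually.of_forall fun v ↦ norm_nonneg _) hint
          (Filter.Eventually.of_forall hle)
    _ = X := by
        rw [integral_indicator_const _ measurableSet_Icc, Real.volume_real_Icc_of_le (by linarith),
          smul_eq_mul]
        ring

/-- `|∫ g₁(x+h) g₂(x) dx| ≤ X` for two test functions of (4.18) on `[X, 2X]` ("the leading term
times `∫g(x+h)ḡ(x)dx`", bounded trivially). [cite: ConreyIwaniec2002, §4 (4.17)–(4.18)] -/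
theorem norm_integral_shift_mul_le (hX : 1 / 2 ≤ X) (hg₁ : IsBumpOn X g₁) (hg₂ : IsBumpOn X g₂)
    (h : ℝ) : ‖∫ x, g₁ (x + h) * g₂ x‖ ≤ X := by
  calc ‖∫ x, g₁ (x + h) * g₂ x‖ ≤ ∫ x, ‖g₁ (x + h) * g₂ x‖ := norm_integral_le_integral_norm _
    _ ≤ ∫ x, ‖g₂ x‖ := by
        refine integral_mono_of_nonneg (Filter.Eventually.of_forall fun _ ↦ norm_nonneg _)
          (integrable_of_isBumpOn hg₂).norm (Filter.Eventually.of_forall fun x ↦ ?_)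
        show ‖g₁ (x + h) * g₂ x‖ ≤ ‖g₂ x‖
        rw [norm_mul]
        exact mul_le_of_le_one_left (norm_nonneg _) (norm_le_one_of_isBumpOn hg₁ _)
    _ ≤ X := integral_norm_le_of_isBumpOn hX hg₂

/-- The class (4.18) is stable under complex conjugation (`‖(conj g)^{(ν)}‖ = ‖g^{(ν)}‖`).
[cite: ConreyIwaniec2002, §4 (4.18)] -/
theorem isBumpOn_conj (hg : IsBumpOn X g) : IsBumpOn X (fun x ↦ conj (g x)) := by
  have hcomp : (fun x ↦ conj (g x)) = Complex.conjLIE ∘ g := by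
    funext x; simp
  refine ⟨?_, fun x hx ↦ by simp [eq_zero_of_isBumpOn hg hx], fun ν hν x ↦ ?_⟩
  · rw [hcomp]; exact Complex.conjLIE.contDiff.comp hg.1
  · have hnorm : ‖iteratedDeriv ν (fun x ↦ conj (g x)) x‖ = ‖iteratedDeriv ν g x‖ := by
      rw [← norm_iteratedFDeriv_eq_norm_iteratedDeriv, ← norm_iteratedFDeriv_eq_norm_iteratedDeriv,
        hcomp, LinearIsometryEquiv.norm_iteratedFDeriv_comp_left]
    rw [hnorm]
    exact hg.2.2 ν hν x

/-! ### The test function `g(x)e(−αx)` of the summation formula -/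

/-- `x ↦ e(−αx)` is smooth. [folklore] -/
private theorem contDiff_fourierChar_neg_mul (α : ℝ) {n : WithTop ℕ∞} :
    ContDiff ℝ n (fun x : ℝ ↦ (𝐞 (-(x * α)) : ℂ)) := by
  have : (fun x : ℝ ↦ (𝐞 (-(x * α)) : ℂ)) =
      fun x ↦ Complex.exp (((2 * Real.pi * (-(x * α)) : ℝ) : ℂ) * Complex.I) := by
    funext x; exact Real.fourierChar_apply _
  rw [this]
  have h1 : ContDiff ℝ n (fun x : ℝ ↦ 2 * Real.pi * (-(x * α))) :=
    contDiff_const.mul ((contDiff_id.mul contDiff_const).neg)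
  have h2 : ContDiff ℝ n (fun x : ℝ ↦ ((2 * Real.pi * (-(x * α)) : ℝ) : ℂ)) :=
    Complex.ofRealCLM.contDiff.comp h1
  exact Complex.contDiff_exp.comp (h2.mul contDiff_const)

/-- `|e(t)| = 1` in `ℂ`. [folklore] -/
private theorem norm_fourierChar (t : ℝ) : ‖(𝐞 t : ℂ)‖ = 1 := Circle.norm_coe _

/-- `conj e(t) = e(−t)`. [folklore] -/
private theorem conj_fourierChar (t : ℝ) : conj ((𝐞 t : ℂ)) = (𝐞 (-t) : ℂ) := by
  rw [← Circle.coe_inv_eq_conj, AddChar.map_neg_eq_inv]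

/-- The test function `G(x) = e(−αx)g(x)` to which (4.3) is applied in the proof of Theorem 4.1
is of class `C²` … [cite: ConreyIwaniec2002, §4, proof of Theorem 4.1 ("By the summation formula (4.3) we have …")] -/
theorem contDiff_test (hg : IsBumpOn X g) (α : ℝ) :
    ContDiff ℝ 2 (fun x : ℝ ↦ (𝐞 (-(x * α)) : ℂ) * g x) :=
  (contDiff_fourierChar_neg_mul α).mul hg.1

/-- … and compactly supported in `(0, ∞)` (`X ≥ 1/2 > 0`).
[cite: ConreyIwaniec2002, §4, proof of Theorem 4.1 ("By the summation formula (4.3) we have …")] -/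
theorem test_eq_zero (hX : 1 / 2 ≤ X) (hg : IsBumpOn X g) (α : ℝ) :
    ∃ X₁ X₂ : ℝ, 0 < X₁ ∧ ∀ x ∉ Set.Icc X₁ X₂, (𝐞 (-(x * α)) : ℂ) * g x = 0 :=
  ⟨X, 2 * X, by linarith, fun x hx ↦ by rw [eq_zero_of_isBumpOn hg hx, mul_zero]⟩

/-- `∫₀^∞ G(x)k(x)dx = (g·k)^(α)` for `G(x) = e(−αx)g(x)`: the integral transforms of (4.3) at the
test function `g(x)e(−αx)` are the Fourier transforms `ĝ_m(α)` of `g_m = g·k_m` (4.5).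
[cite: ConreyIwaniec2002, §4 (4.5), proof of Theorem 4.1] -/
theorem integral_Ioi_test_mul_eq_fourier (hX : 1 / 2 ≤ X) (hg : IsBumpOn X g) (k : ℝ → ℂ)
    (α : ℝ) :
    ∫ x in Set.Ioi 0, (𝐞 (-(x * α)) : ℂ) * g x * k x = 𝓕 (fun x ↦ g x * k x) α := by
  rw [setIntegral_eq_integral_of_forall_compl_eq_zero, Real.fourier_real_eq]
  · refine integral_congr_ae (Filter.Eventually.of_forall fun x ↦ ?_)
    simp only [Circle.smul_def, smul_eq_mul]
    ring
  · intro x hx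
    have hx' : x ∉ Icc X (2 * X) := fun h ↦ hx (lt_of_lt_of_le (by linarith) h.1)
    rw [eq_zero_of_isBumpOn hg hx', mul_zero, zero_mul]

/-- `∫₀^∞ G(x)dx = ĝ(α)` for `G(x) = e(−αx)g(x)` (the term `m = 0`, `k₀ = 1` (4.6)).
[cite: ConreyIwaniec2002, §4 (4.6), proof of Theorem 4.1] -/
theorem integral_Ioi_test_eq_fourier (hX : 1 / 2 ≤ X) (hg : IsBumpOn X g) (α : ℝ) :
    ∫ x in Set.Ioi 0, (𝐞 (-(x * α)) : ℂ) * g x = 𝓕 g α := by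
  have := integral_Ioi_test_mul_eq_fourier hX hg (fun _ ↦ 1) α
  simp only [mul_one] at this
  exact this

/-! ### (4.8)–(4.9) from the decay (4.24) -/

/-- `u ↦ (1 + |u|)^{-2}` is integrable on `ℝ`. [folklore] -/
private theorem integrable_inv_one_add_abs_sq : Integrable (fun u : ℝ ↦ ((1 + |u|) ^ 2)⁻¹) := by
  have := integrable_one_add_norm (E := ℝ) (μ := volume) (r := 2) (by simp)
  refine this.congr (Filter.Eventually.of_forall fun u ↦ ?_)
  simp only [Real.norm_eq_abs]
  rw [Real.rpow_neg (by positivity)]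
  norm_num

/-- `u ↦ (1 + |u|)^{-3}` is integrable on `ℝ`. [folklore] -/
private theorem integrable_inv_one_add_abs_cube : Integrable (fun u : ℝ ↦ ((1 + |u|) ^ 3)⁻¹) := by
  have := integrable_one_add_norm (E := ℝ) (μ := volume) (r := 3) (by simp)
  refine this.congr (Filter.Eventually.of_forall fun u ↦ ?_)
  simp only [Real.norm_eq_abs]
  rw [Real.rpow_neg (by positivity)]
  norm_num

/-- The transform of a test function is continuous. [cite: ConreyIwaniec2002, §4 (4.24)] -/
theorem continuous_fourier_bump (hg : IsBumpOn X g) : Continuous (𝓕 g) :=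
  VectorFourier.fourierIntegral_continuous Real.continuous_fourierChar continuous_inner
    (integrable_of_isBumpOn hg)

/-- The majorant of (4.24), `α ↦ c₁X(1 + |α|X)^{-2}`, is integrable with integral `c₁·I₂`,
`I₂ = ∫(1+|u|)^{-2}du` (substitution `u = Xα`). [cite: ConreyIwaniec2002, §4 (4.24), (4.8)] -/
theorem integral_decay_majorant (hX : 1 / 2 ≤ X) (c₁ : ℝ) :
    Integrable (fun α : ℝ ↦ c₁ * X / (1 + |α| * X) ^ 2) ∧
      ∫ α : ℝ, c₁ * X / (1 + |α| * X) ^ 2 = c₁ * ∫ u : ℝ, ((1 + |u|) ^ 2)⁻¹ := by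
  have hX0 : 0 < X := by linarith
  have heq : (fun α : ℝ ↦ c₁ * X / (1 + |α| * X) ^ 2) =
      fun α ↦ (c₁ * X) * (fun u : ℝ ↦ ((1 + |u|) ^ 2)⁻¹) (X * α) := by
    funext α
    simp only [abs_mul, abs_of_pos hX0]
    rw [div_eq_mul_inv, mul_comm X |α|]
  rw [heq]
  constructor
  · exact ((integrable_inv_one_add_abs_sq.comp_mul_left' hX0.ne')).const_mul _
  · rw [integral_const_mul, Measure.integral_comp_mul_left (fun u : ℝ ↦ ((1 + |u|) ^ 2)⁻¹) X,
      abs_of_pos (inv_pos.mpr hX0), smul_eq_mul]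
    field_simp

/-- **(4.8)**: `ĝ` is integrable … [cite: ConreyIwaniec2002, §4 (4.8)] -/
theorem integrable_fourier_bump (hF : BumpFourierDecay c₁) (hX : 1 / 2 ≤ X) (hg : IsBumpOn X g) :
    Integrable (𝓕 g) :=
  Integrable.mono' (integral_decay_majorant hX c₁).1
    (continuous_fourier_bump hg).aestronglyMeasurable
    (Filter.Eventually.of_forall fun α ↦ hF X hX g hg α)

/-- **(4.8)**: … with `∫|ĝ(α)|dα ≤ c₁·I₂`, `I₂ = ∫(1+|u|)^{-2}du` ("(4.8) holds with `B = 1`" up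
to the absolute constant). [cite: ConreyIwaniec2002, §4 (4.8)] -/
theorem integral_norm_fourier_le (hF : BumpFourierDecay c₁) (hX : 1 / 2 ≤ X)
    (hg : IsBumpOn X g) : ∫ α, ‖𝓕 g α‖ ≤ c₁ * ∫ u : ℝ, ((1 + |u|) ^ 2)⁻¹ := by
  rw [← (integral_decay_majorant hX c₁).2]
  exact integral_mono_of_nonneg (Filter.Eventually.of_forall fun _ ↦ norm_nonneg _)
    (integral_decay_majorant hX c₁).1 (Filter.Eventually.of_forall fun α ↦ hF X hX g hg α)

/-- The majorant of `|α||ĝ₁(α)||ĝ₂(α)|`, `α ↦ c₁²X(1 + |α|X)^{-3}`, is integrable with integral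
`c₁²·I₃`, `I₃ = ∫(1+|u|)^{-3}du`. [cite: ConreyIwaniec2002, §4 (4.24), (4.9)] -/
theorem integral_decay_majorant_three (hX : 1 / 2 ≤ X) (c₁ : ℝ) :
    Integrable (fun α : ℝ ↦ c₁ ^ 2 * X / (1 + |α| * X) ^ 3) ∧
      ∫ α : ℝ, c₁ ^ 2 * X / (1 + |α| * X) ^ 3 = c₁ ^ 2 * ∫ u : ℝ, ((1 + |u|) ^ 3)⁻¹ := by
  have hX0 : 0 < X := by linarith
  have heq : (fun α : ℝ ↦ c₁ ^ 2 * X / (1 + |α| * X) ^ 3) =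
      fun α ↦ (c₁ ^ 2 * X) * (fun u : ℝ ↦ ((1 + |u|) ^ 3)⁻¹) (X * α) := by
    funext α
    simp only [abs_mul, abs_of_pos hX0]
    rw [div_eq_mul_inv, mul_comm X |α|]
  rw [heq]
  constructor
  · exact ((integrable_inv_one_add_abs_cube.comp_mul_left' hX0.ne')).const_mul _
  · rw [integral_const_mul, Measure.integral_comp_mul_left (fun u : ℝ ↦ ((1 + |u|) ^ 3)⁻¹) X,
      abs_of_pos (inv_pos.mpr hX0), smul_eq_mul]
    field_simp

/-- Pointwise: `|α||ĝ₁(α)||ĝ₂(α)| ≤ c₁²X(1+|α|X)^{-3}` from (4.24) for both factors.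
[cite: ConreyIwaniec2002, §4 (4.24), (4.9)] -/
theorem abs_mul_norm_fourier_mul_le (hF : BumpFourierDecay c₁) (hc₁ : 0 < c₁) (hX : 1 / 2 ≤ X)
    (hg₁ : IsBumpOn X g₁) (hg₂ : IsBumpOn X g₂) (α : ℝ) :
    |α| * (‖𝓕 g₁ α‖ * ‖𝓕 g₂ α‖) ≤ c₁ ^ 2 * X / (1 + |α| * X) ^ 3 := by
  have hX0 : 0 < X := by linarith
  have h1 := hF X hX g₁ hg₁ α
  have h2 := hF X hX g₂ hg₂ α
  have ht : 0 < 1 + |α| * X := by positivity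
  have hprod : ‖𝓕 g₁ α‖ * ‖𝓕 g₂ α‖ ≤ (c₁ * X / (1 + |α| * X) ^ 2) * (c₁ * X / (1 + |α| * X) ^ 2) :=
    mul_le_mul h1 h2 (norm_nonneg _) (by positivity)
  calc |α| * (‖𝓕 g₁ α‖ * ‖𝓕 g₂ α‖)
      ≤ |α| * ((c₁ * X / (1 + |α| * X) ^ 2) * (c₁ * X / (1 + |α| * X) ^ 2)) :=
        mul_le_mul_of_nonneg_left hprod (abs_nonneg α)
    _ = c₁ ^ 2 * X / (1 + |α| * X) ^ 3 * (|α| * X / (1 + |α| * X)) := by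
        field_simp
    _ ≤ c₁ ^ 2 * X / (1 + |α| * X) ^ 3 * 1 := by
        refine mul_le_mul_of_nonneg_left ?_ (by positivity)
        rw [div_le_one ht]
        linarith
    _ = c₁ ^ 2 * X / (1 + |α| * X) ^ 3 := mul_one _

/-- **(4.9) for a pair**: `α ↦ |α||ĝ₁(α)||ĝ₂(α)|` is integrable …
[cite: ConreyIwaniec2002, §4 (4.9)] -/
theorem integrable_abs_mul_norm_fourier_mul (hF : BumpFourierDecay c₁) (hc₁ : 0 < c₁)
    (hX : 1 / 2 ≤ X) (hg₁ : IsBumpOn X g₁) (hg₂ : IsBumpOn X g₂) :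
    Integrable (fun α : ℝ ↦ |α| * (‖𝓕 g₁ α‖ * ‖𝓕 g₂ α‖)) := by
  refine Integrable.mono' (integral_decay_majorant_three hX c₁).1 ?_
    (Filter.Eventually.of_forall fun α ↦ ?_)
  · exact (continuous_abs.mul ((continuous_fourier_bump hg₁).norm.mul
      (continuous_fourier_bump hg₂).norm)).aestronglyMeasurable
  · rw [Real.norm_eq_abs, abs_of_nonneg (by positivity)]
    exact abs_mul_norm_fourier_mul_le hF hc₁ hX hg₁ hg₂ α

/-- **(4.9) for a pair**: … with `∫|α||ĝ₁(α)||ĝ₂(α)|dα ≤ c₁²·I₃`, `I₃ = ∫(1+|u|)^{-3}du`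
("(4.9) holds with `B = 1`" up to the absolute constant). [cite: ConreyIwaniec2002, §4 (4.9)] -/
theorem integral_abs_mul_norm_fourier_mul_le (hF : BumpFourierDecay c₁) (hc₁ : 0 < c₁)
    (hX : 1 / 2 ≤ X) (hg₁ : IsBumpOn X g₁) (hg₂ : IsBumpOn X g₂) :
    ∫ α, |α| * (‖𝓕 g₁ α‖ * ‖𝓕 g₂ α‖) ≤ c₁ ^ 2 * ∫ u : ℝ, ((1 + |u|) ^ 3)⁻¹ := by
  rw [← (integral_decay_majorant_three hX c₁).2]
  exact integral_mono_of_nonneg (Filter.Eventually.of_forall fun _ ↦ by positivity)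
    (integral_decay_majorant_three hX c₁).1
    (Filter.Eventually.of_forall fun α ↦ abs_mul_norm_fourier_mul_le hF hc₁ hX hg₁ hg₂ α)

/-- `|ĝ(α)| ≤ c₁X` (the decay bound at its weakest). [cite: ConreyIwaniec2002, §4 (4.24)] -/
theorem norm_fourier_le_const (hF : BumpFourierDecay c₁) (hc₁ : 0 < c₁) (hX : 1 / 2 ≤ X)
    (hg : IsBumpOn X g) (α : ℝ) : ‖𝓕 g α‖ ≤ c₁ * X := by
  have hX0 : 0 < X := by linarith
  refine (hF X hX g hg α).trans ?_
  rw [div_le_iff₀ (by positivity)]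
  have h1 : (1 : ℝ) ≤ (1 + |α| * X) ^ 2 := one_le_pow₀ (by nlinarith [abs_nonneg α])
  calc c₁ * X = c₁ * X * 1 := (mul_one _).symm
    _ ≤ c₁ * X * (1 + |α| * X) ^ 2 := mul_le_mul_of_nonneg_left h1 (by positivity)

/-- `α ↦ |ĝ₁(α)||ĝ₂(α)|` is integrable. [cite: ConreyIwaniec2002, §4 (4.8)] -/
theorem integrable_norm_fourier_mul (hF : BumpFourierDecay c₁) (hc₁ : 0 < c₁) (hX : 1 / 2 ≤ X)
    (hg₁ : IsBumpOn X g₁) (hg₂ : IsBumpOn X g₂) :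
    Integrable (fun α : ℝ ↦ ‖𝓕 g₁ α‖ * ‖𝓕 g₂ α‖) := by
  have h := (integrable_fourier_bump hF hX hg₁).norm.bdd_mul (c := c₁ * X)
    (continuous_fourier_bump hg₂).norm.aestronglyMeasurable
    (Filter.Eventually.of_forall fun α ↦ by
      rw [Real.norm_eq_abs, abs_of_nonneg (norm_nonneg _)]
      exact norm_fourier_le_const hF hc₁ hX hg₂ α)
  exact h.congr (Filter.Eventually.of_forall fun α ↦ mul_comm _ _)

/-- **The tail of the `α`-integral**: for `T > 0`,
`∫_{|α| > T} |ĝ₁(α)||ĝ₂(α)| dα ≤ c₁²I₃/T` (since `1 ≤ |α|/T` there) — the cost of "extending the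
integration to all `α ∈ ℝ`" in the leading term. [cite: ConreyIwaniec2002, §4, proof of Theorem 4.1 (leading term)] -/
theorem integral_norm_fourier_mul_tail_le (hF : BumpFourierDecay c₁) (hc₁ : 0 < c₁)
    (hX : 1 / 2 ≤ X) (hg₁ : IsBumpOn X g₁) (hg₂ : IsBumpOn X g₂) {T : ℝ} (hT : 0 < T) :
    ∫ α in {α : ℝ | T < |α|}, ‖𝓕 g₁ α‖ * ‖𝓕 g₂ α‖ ≤
      (c₁ ^ 2 * ∫ u : ℝ, ((1 + |u|) ^ 3)⁻¹) / T := by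
  rw [le_div_iff₀ hT]
  have hint := integrable_abs_mul_norm_fourier_mul hF hc₁ hX hg₁ hg₂
  have hP := integrable_norm_fourier_mul hF hc₁ hX hg₁ hg₂
  have hs : MeasurableSet {α : ℝ | T < |α|} :=
    measurableSet_lt measurable_const continuous_abs.measurable
  calc (∫ α in {α : ℝ | T < |α|}, ‖𝓕 g₁ α‖ * ‖𝓕 g₂ α‖) * T
      = ∫ α in {α : ℝ | T < |α|}, T * (‖𝓕 g₁ α‖ * ‖𝓕 g₂ α‖) := by
        rw [integral_const_mul]; ring
    _ ≤ ∫ α in {α : ℝ | T < |α|}, |α| * (‖𝓕 g₁ α‖ * ‖𝓕 g₂ α‖) :=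
        setIntegral_mono_on (hP.const_mul T).integrableOn hint.integrableOn hs
          fun α hα ↦ mul_le_mul_of_nonneg_right (le_of_lt hα) (by positivity)
    _ ≤ ∫ α, |α| * (‖𝓕 g₁ α‖ * ‖𝓕 g₂ α‖) :=
        setIntegral_le_integral hint (Filter.Eventually.of_forall fun _ ↦ by positivity)
    _ ≤ c₁ ^ 2 * ∫ u : ℝ, ((1 + |u|) ^ 3)⁻¹ := integral_abs_mul_norm_fourier_mul_le hF hc₁ hX hg₁ hg₂

/-! ### Plancherel with a shift -/

/-- `𝓕⁻ f w = ∫ e(vw) f(v) dv` on `ℝ`. [folklore] -/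
private theorem fourierInv_real_eq (f : ℝ → ℂ) (w : ℝ) :
    𝓕⁻ f w = ∫ v : ℝ, (𝐞 (v * w) : ℂ) * f v := by
  rw [Real.fourierInv_eq_fourier_neg, Real.fourier_real_eq]
  refine integral_congr_ae (Filter.Eventually.of_forall fun v ↦ ?_)
  simp only [Circle.smul_def, smul_eq_mul, mul_neg, neg_neg]

/-- `conj((conj g)^(ξ)) = ĝ(−ξ)`. [folklore] -/
private theorem conj_fourier_conj (g : ℝ → ℂ) (ξ : ℝ) :
    conj (𝓕 (fun x ↦ conj (g x)) ξ) = 𝓕 g (-ξ) := by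
  rw [Real.fourier_real_eq, Real.fourier_real_eq, ← integral_conj]
  refine integral_congr_ae (Filter.Eventually.of_forall fun v ↦ ?_)
  simp only [Circle.smul_def, smul_eq_mul, map_mul, Complex.conj_conj, conj_fourierChar, mul_neg,
    neg_neg]

/-- The multiplication formula `∫ f̂·G = ∫ f·Ĝ` on `ℝ` (Mathlib's
`VectorFourier.integral_fourierIntegral_smul_eq_flip`). [folklore] -/
private theorem integral_fourier_mul_eq_integral_mul_fourier {f G : ℝ → ℂ} (hf : Integrable f)
    (hG : Integrable G) : ∫ ξ, 𝓕 f ξ * G ξ = ∫ x, f x * 𝓕 G x := by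
  have := VectorFourier.integral_fourierIntegral_smul_eq_flip (L := innerₗ ℝ) (μ := volume)
    (ν := volume) Real.continuous_fourierChar continuous_inner hf hG
  simp only [flip_innerₗ, smul_eq_mul] at this
  exact this

/-- **Plancherel with a shift** ("by the Plancherel theorem
`∫ e(αh)|ĝ(α)|²dα = ∫ g(x+h)ḡ(x)dx`", in the two-function form of the Remarks after (4.17)):
for test functions `g₁, g₂` of (4.18) and any real `h`,
`∫ ĝ₁(α)·conj((conj g₂)^(α))·e(hα) dα = ∫ g₁(x+h)g₂(x) dx`. Proof: `conj((conj g₂)^(α)) = ĝ₂(−α)`,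
the multiplication formula with `G(α) = ĝ₂(−α)e(hα)`, `Ĝ(x) = 𝓕⁻(ĝ₂)(x − h) = g₂(x − h)` by
Fourier inversion (`g₂` continuous and integrable with integrable transform, by (4.24)), and the
translation `x ↦ x + h`. [cite: ConreyIwaniec2002, §4, proof of Theorem 4.1 (Plancherel step) and Remarks after (4.17)] -/
theorem integral_fourier_mul_conj_fourier_conj_mul_fourierChar (hF : BumpFourierDecay c₁)
    (hX : 1 / 2 ≤ X) (hg₁ : IsBumpOn X g₁) (hg₂ : IsBumpOn X g₂) (h : ℝ) :
    ∫ α, 𝓕 g₁ α * conj (𝓕 (fun x ↦ conj (g₂ x)) α) * (𝐞 (h * α) : ℂ) =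
      ∫ x, g₁ (x + h) * g₂ x := by
  -- the auxiliary function `G(α) = ĝ₂(−α) e(hα)` and its transform
  set G : ℝ → ℂ := fun α ↦ 𝓕 g₂ (-α) * (𝐞 (h * α) : ℂ) with hGdef
  have hFg₂ : Integrable (𝓕 g₂) := integrable_fourier_bump hF hX hg₂
  have hGint : Integrable G := by
    refine (hFg₂.comp_neg).mul_bdd (c := 1) ?_ (Filter.Eventually.of_forall fun α ↦ ?_)
    · exact (Continuous.aestronglyMeasurable (by
        have : (fun α : ℝ ↦ (𝐞 (h * α) : ℂ)) =
            fun α ↦ Complex.exp (((2 * Real.pi * (h * α) : ℝ) : ℂ) * Complex.I) := by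
          funext α; exact Real.fourierChar_apply _
        rw [this]; fun_prop))
    · rw [norm_fourierChar]
  have hFG : ∀ x : ℝ, 𝓕 G x = g₂ (x - h) := by
    intro x
    have hinv : 𝓕⁻ (𝓕 g₂) (x - h) = g₂ (x - h) :=
      congr_fun ((continuous_of_isBumpOn hg₂).fourierInv_fourier_eq (integrable_of_isBumpOn hg₂)
        hFg₂) (x - h)
    rw [← hinv, fourierInv_real_eq, Real.fourier_real_eq,
      ← integral_neg_eq_self (fun α : ℝ ↦ 𝐞 (-(α * x)) • G α) volume]
    refine integral_congr_ae (Filter.Eventually.of_forall fun α ↦ ?_)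
    simp only [hGdef, Circle.smul_def, smul_eq_mul, neg_mul, neg_neg]
    rw [show (𝐞 (α * (x - h)) : ℂ) = (𝐞 (α * x) : ℂ) * (𝐞 (h * -α) : ℂ) by
      rw [← Circle.coe_mul, ← AddChar.map_add_eq_mul]; congr 2; ring]
    ring
  calc ∫ α, 𝓕 g₁ α * conj (𝓕 (fun x ↦ conj (g₂ x)) α) * (𝐞 (h * α) : ℂ)
      = ∫ α, 𝓕 g₁ α * G α := by
        refine integral_congr_ae (Filter.Eventually.of_forall fun α ↦ ?_)
        simp only [hGdef, conj_fourier_conj, mul_assoc]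
    _ = ∫ x, g₁ x * 𝓕 G x :=
        integral_fourier_mul_eq_integral_mul_fourier (integrable_of_isBumpOn hg₁) hGint
    _ = ∫ x, g₁ x * g₂ (x - h) := by simp_rw [hFG]
    _ = ∫ x, g₁ (x + h) * g₂ x := by
        rw [← integral_add_right_eq_self (fun x ↦ g₁ x * g₂ (x - h)) h]
        simp only [add_sub_cancel_right]

end CircleMethod

end ConreyIwaniec2002

end Literature.NumberTheory.LFunctions

end
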